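import Mathlib
import HarnessLib
import Literature.NumberTheory.LFunctions.HorocyclePhaseWeighted

/-!
# The `w`-derivative of the Fourier coefficients of the horocycle integral

Support file (all statements PROVED, no definitions, no named facts) for the elementary proof of
the conditional rate of equidistribution of closed horocycles
(`Literature.NumberTheory.LFunctions.horocycleRate_of_quasiRH`, `HorocycleRH.lean`; Zagier 1981 §1
p. 279, Sarnak 1981 Thm. 1). After unfolding, the horocycle average at height `y = l²` is a sum
of the Fourier coefficients `b_k(w)` of the horocycle integral `Ψ(w,θ)` of a strip test `f`
evaluated at `w = (e l m)²` against `μ(m)`; Abel summation against `μ(m)` with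
`M(x) = O(x^{θ+ε})` needs the DERIVATIVE of `w ↦ b_k(w)`, which this file controls:

* `HorocycleStripFourier.contDiff_im_mul`, `periodic_im_mul`, `support_im_mul`, `coeff_im_mul` —
  the strip-test class is stable under `f ↦ (im z) f`, and the coefficients of `(im z) f` along
  the line at height `h` are `h g_k(h)`;
* `hasDerivAt_X_w`, `hasDerivAt_Y_w` — `∂_w X_w(t) = t/(w²(1+t²))`, `∂_w Y_w(t) = -1/(w²(1+t²))`;
* `hasDerivAt_coeff_integral` — differentiation under the integral sign:
  `b_k'(w) = ∫ e(kX_w)(2πik ∂_wX · g_k(Y_w) + ∂_wY · g_k^{(Df·I)}(Y_w)) dt` (dominated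
  differentiation on `w > w₀/2`, the integrands living on `|t| ≤ √(2/(w₀a))`);
* `exists_norm_coeffDeriv_le` — **`‖b_k'(w)‖ ≤ M'/(k² w)`** uniformly in `w > 0`, `k ≠ 0`:
  `w b_k'(w) = 2πik ∫ e(kX) t G₃(Y) − ∫ e(kX) G₂(Y)` with `G₃`, `G₂` the coefficients of
  `(im z) f` and `(im z) Df·I`; the second is a horocycle coefficient (`≤ M₂/|k|³`, tree
  `exists_norm_coeffPsi_le`), the first is `O(|k|⁻⁵)` for `w ≤ 1/(3b)` by two integrations by
  parts (`norm_phase_integral_mul_le_of_le` fed with the `C/|k|³` bounds `exists_norm_coeff_le`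
  for `G₃, G₃', G₃''`) and `O(|k|⁻³)` for `w ≥ 1/(3b)`.

## References
* H. Iwaniec, *Spectral Methods of Automorphic Forms*, 2nd ed., AMS GSM 53 (2002), §3.4
  [Iwaniec2002].
* P. Sarnak, *Asymptotic behavior of periodic orbits of the horocycle flow and Eisenstein
  series*, Comm. Pure Appl. Math. 34 (1981), 719–739, Thm. 1 [Sarnak1981].

## Mathlib / tree search
Mathlib: `hasDerivAt_integral_of_dominated_loc_of_deriv_le`. Tree: `HorocycleStripFourier.*`
(`hasDerivAt_coeff`, `exists_norm_coeff_le`, `contDiff_fderiv_apply`, …),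
`HorocyclePhase.coeff_integral_apply_hpt`, `exists_norm_coeffPsi_le`, `coeff_support`,
`norm_phase_integral_mul_le_of_le/ge` (`HorocyclePhaseWeighted.lean`).
-/

noncomputable section


open Complex MeasureTheory Set Filter Topology intervalIntegral
open scoped Real ContDiff

namespace Literature.NumberTheory.LFunctions

namespace HorocycleStripFourier

variable {f : ℂ → ℂ} {a b : ℝ}

/-! ### Multiplication by the height keeps the class -/

/-- `z ↦ (im z) f(z)` is smooth. [folklore] -/
theorem contDiff_im_mul (hf : ContDiff ℝ ∞ f) : ContDiff ℝ ∞ fun z : ℂ => (z.im : ℂ) * f z :=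
  (Complex.ofRealCLM.contDiff.comp Complex.imCLM.contDiff).mul hf

/-- `z ↦ (im z) f(z)` is `1`-periodic with `f`. [folklore] -/
theorem periodic_im_mul (hper : ∀ z, f (z + 1) = f z) (z : ℂ) :
    (((z + 1).im : ℝ) : ℂ) * f (z + 1) = ((z.im : ℝ) : ℂ) * f z := by
  rw [hper]; simp

/-- `z ↦ (im z) f(z)` has the strip support of `f`. [folklore] -/
theorem support_im_mul (hsupp : ∀ z, f z ≠ 0 → a ≤ z.im ∧ z.im ≤ b) (z : ℂ)
    (hz : ((z.im : ℝ) : ℂ) * f z ≠ 0) : a ≤ z.im ∧ z.im ≤ b :=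
  hsupp z (right_ne_zero_of_mul hz)

/-- The coefficients of `z ↦ (im z) f(z)` along the line at height `h` are `h` times those of
`f`. [folklore] -/
theorem coeff_im_mul (f : ℂ → ℂ) (h : ℝ) (k : ℤ) :
    ∫ x in (0:ℝ)..1, ((((x : ℂ) + h * I).im : ℝ) : ℂ) * f (x + h * I) *
        Complex.exp (-(2 * π * I * k * x)) =
      (h : ℂ) * ∫ x in (0:ℝ)..1, f (x + h * I) * Complex.exp (-(2 * π * I * k * x)) := by
  rw [← intervalIntegral.integral_const_mul]
  refine intervalIntegral.integral_congr fun x _ => ?_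
  have : (((x : ℂ) + h * I).im : ℝ) = h := by simp
  rw [this]; ring

end HorocycleStripFourier

namespace HorocyclePhase

open HorocycleStripFourier

variable {f : ℂ → ℂ} {a b : ℝ}

/-! ### Differentiating the coefficient `b_k(w) = ∫ e(kX_w(t)) g_k(Y_w(t)) dt` in `w` -/

/-- `d/dw (-t/(w(1+t²))) = t/(w²(1+t²))`. [folklore] -/
theorem hasDerivAt_X_w {w : ℝ} (hw : w ≠ 0) (t : ℝ) :
    HasDerivAt (fun w : ℝ => -t / (w * (1 + t ^ 2))) (t / (w ^ 2 * (1 + t ^ 2))) w := by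
  have ht : (1 + t ^ 2) ≠ 0 := by positivity
  have h1 : HasDerivAt (fun w : ℝ => w * (1 + t ^ 2)) (1 * (1 + t ^ 2)) w :=
    (hasDerivAt_id w).mul_const _
  refine ((hasDerivAt_const w (-t)).div h1 (mul_ne_zero hw ht)).congr_deriv ?_
  field_simp
  ring

/-- `d/dw (1/(w(1+t²))) = -1/(w²(1+t²))`. [folklore] -/
theorem hasDerivAt_Y_w {w : ℝ} (hw : w ≠ 0) (t : ℝ) :
    HasDerivAt (fun w : ℝ => 1 / (w * (1 + t ^ 2))) (-1 / (w ^ 2 * (1 + t ^ 2))) w := by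
  have ht : (1 + t ^ 2) ≠ 0 := by positivity
  have h1 : HasDerivAt (fun w : ℝ => w * (1 + t ^ 2)) (1 * (1 + t ^ 2)) w :=
    (hasDerivAt_id w).mul_const _
  refine ((hasDerivAt_const w (1:ℝ)).div h1 (mul_ne_zero hw ht)).congr_deriv ?_
  field_simp
  ring

/-- **The `w`-derivative of the coefficient integral.** For a strip test `f` (`0 < a ≤ b`),
`k ∈ ℤ` and `w₀ > 0`, the phase-integral form of the coefficient
`b_k(w) = ∫_ℝ e(kX_w(t)) g_k(Y_w(t)) dt` (`g_k(h) = ∫₀¹ f(x+ih)e(-kx)dx`) is differentiable at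
`w₀`, with derivative obtained by differentiating under the integral sign:
`b_k'(w₀) = ∫_ℝ e(kX_{w₀}(t)) (2πik ∂_wX · g_k(Y) + ∂_wY · g_k^{(Df·I)}(Y)) dt`,
`∂_w X_w = t/(w²(1+t²))`, `∂_w Y_w = -1/(w²(1+t²))` (dominated differentiation on
`w > w₀/2`, where the integrands live on `|t| ≤ √(2/(w₀a))`). [folklore] -/
theorem hasDerivAt_coeff_integral (hf : ContDiff ℝ ∞ f) (hper : ∀ z, f (z + 1) = f z)
    (hsupp : ∀ z, f z ≠ 0 → a ≤ z.im ∧ z.im ≤ b) (ha : 0 < a) (k : ℤ) {w₀ : ℝ} (hw₀ : 0 < w₀) :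
    HasDerivAt (fun w : ℝ => ∫ t : ℝ, Complex.exp (2 * π * I * k * (-t / (w * (1 + t ^ 2)))) *
        ∫ x in (0:ℝ)..1, f (x + (1 / (w * (1 + t ^ 2)) : ℝ) * I) *
          Complex.exp (-(2 * π * I * k * x)))
      (∫ t : ℝ, Complex.exp (2 * π * I * k * (-t / (w₀ * (1 + t ^ 2)))) *
        ((2 * π * I * k * ((t / (w₀ ^ 2 * (1 + t ^ 2)) : ℝ) : ℂ)) *
            (∫ x in (0:ℝ)..1, f (x + (1 / (w₀ * (1 + t ^ 2)) : ℝ) * I) *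
              Complex.exp (-(2 * π * I * k * x))) +
          ((-1 / (w₀ ^ 2 * (1 + t ^ 2)) : ℝ) : ℂ) *
            ∫ x in (0:ℝ)..1, fderiv ℝ f (x + (1 / (w₀ * (1 + t ^ 2)) : ℝ) * I) I *
              Complex.exp (-(2 * π * I * k * x)))) w₀ := by
  -- the coefficient functions along horizontal lines and their bounds
  set g : ℝ → ℂ := fun h => ∫ x in (0:ℝ)..1, f (x + h * I) * Complex.exp (-(2 * π * I * k * x))
    with hg
  set g₁ : ℝ → ℂ := fun h => ∫ x in (0:ℝ)..1, fderiv ℝ f (x + h * I) I *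
    Complex.exp (-(2 * π * I * k * x)) with hg₁
  have hgd : ∀ h, HasDerivAt g (g₁ h) h := fun h => hasDerivAt_coeff hf hper hsupp k h
  have hgc : Continuous g := continuous_iff_continuousAt.2 fun h => (hgd h).continuousAt
  have hfI : ContDiff ℝ ∞ (fun z => fderiv ℝ f z I) := contDiff_fderiv_apply hf I
  have hpI : ∀ z, fderiv ℝ f (z + 1) I = fderiv ℝ f z I := periodic_fderiv_apply hper I
  have hsI : ∀ z, fderiv ℝ f z I ≠ 0 → a ≤ z.im ∧ z.im ≤ b := support_fderiv_apply hsupp I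
  have hg₁c : Continuous g₁ := continuous_coeff hfI hpI hsI k
  obtain ⟨C₀, hC₀0, hC₀⟩ := exists_bound hf.continuous hper hsupp
  obtain ⟨C₁, hC₁0, hC₁⟩ := exists_bound hfI.continuous hpI hsI
  have hS₀ : ∀ h, ‖g h‖ ≤ C₀ := fun h => by
    have := intervalIntegral.norm_integral_le_of_norm_le_const (a := (0:ℝ)) (b := 1) (C := C₀)
      (f := fun x => f (x + h * I) * Complex.exp (-(2 * π * I * k * x))) (fun x _ => by
        rw [norm_mul, norm_exp_neg_two_pi_mul, mul_one]; exact hC₀ _)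
    simpa [hg] using this
  have hS₁ : ∀ h, ‖g₁ h‖ ≤ C₁ := fun h => by
    have := intervalIntegral.norm_integral_le_of_norm_le_const (a := (0:ℝ)) (b := 1) (C := C₁)
      (f := fun x => fderiv ℝ f (x + h * I) I * Complex.exp (-(2 * π * I * k * x))) (fun x _ => by
        rw [norm_mul, norm_exp_neg_two_pi_mul, mul_one]; exact hC₁ _)
    simpa [hg₁] using this
  have hgs : ∀ h, h < a → g h = 0 := fun h hh => coeff_eq_zero_of_not_mem hsupp (Or.inl hh) k
  have hg₁s : ∀ h, h < a → g₁ h = 0 := fun h hh => coeff_eq_zero_of_not_mem hsI (Or.inl hh) k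
  -- the integrand and its `w`-derivative
  set F : ℝ → ℝ → ℂ := fun w t => Complex.exp (2 * π * I * k * (-t / (w * (1 + t ^ 2)))) *
    g (1 / (w * (1 + t ^ 2))) with hF
  set F' : ℝ → ℝ → ℂ := fun w t => Complex.exp (2 * π * I * k * (-t / (w * (1 + t ^ 2)))) *
    ((2 * π * I * k * ((t / (w ^ 2 * (1 + t ^ 2)) : ℝ) : ℂ)) * g (1 / (w * (1 + t ^ 2))) +
      ((-1 / (w ^ 2 * (1 + t ^ 2)) : ℝ) : ℂ) * g₁ (1 / (w * (1 + t ^ 2)))) with hF'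
  change HasDerivAt (fun w => ∫ t, F w t) (∫ t, F' w₀ t) w₀
  -- the neighbourhood `w > w₀/2` and the support bound `T₀`
  set T₀ : ℝ := Real.sqrt (2 / (w₀ * a)) with hT₀
  have hT₀2 : T₀ ^ 2 = 2 / (w₀ * a) := Real.sq_sqrt (by positivity)
  have hsmall : ∀ w : ℝ, w₀ / 2 < w → ∀ t : ℝ, T₀ < |t| → 1 / (w * (1 + t ^ 2)) < a := by
    intro w hw t ht
    have hw' : 0 < w := by linarith
    rw [div_lt_iff₀ (by positivity)]
    have ht2 : 2 / (w₀ * a) < t ^ 2 := by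
      calc 2 / (w₀ * a) = T₀ ^ 2 := hT₀2.symm
        _ < |t| ^ 2 := by gcongr
        _ = t ^ 2 := sq_abs t
    rw [div_lt_iff₀ (by positivity)] at ht2
    nlinarith [mul_pos (sub_pos.2 hw) (by positivity : (0:ℝ) < a * (1 + t ^ 2)), ht2]
  have hzero : ∀ w : ℝ, w₀ / 2 < w → ∀ t : ℝ, T₀ < |t| → F' w t = 0 := by
    intro w hw t ht
    have h1 := hsmall w hw t ht
    simp only [hF', hgs _ h1, hg₁s _ h1, mul_zero, add_zero]
  -- continuity in `t`
  have hcontF : ∀ w : ℝ, w ≠ 0 → Continuous (F w) := by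
    intro w hw
    simp only [hF]
    exact continuous_phase_integrand hw k hgc
  have hden : ∀ (w : ℝ), w ≠ 0 → ∀ t : ℝ, (w * (1 + t ^ 2)) ≠ 0 := fun w hw t =>
    mul_ne_zero hw (by positivity)
  have hden2 : ∀ (w : ℝ), w ≠ 0 → ∀ t : ℝ, (w ^ 2 * (1 + t ^ 2)) ≠ 0 := fun w hw t =>
    mul_ne_zero (pow_ne_zero 2 hw) (by positivity)
  have hcontF' : ∀ w : ℝ, w ≠ 0 → Continuous (F' w) := by
    intro w hw
    simp only [hF']
    have hY : Continuous fun t : ℝ => 1 / (w * (1 + t ^ 2)) :=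
      continuous_const.div (by fun_prop) (hden w hw)
    refine Continuous.mul (Continuous.cexp ?_) (Continuous.add ?_ ?_)
    · refine continuous_const.mul (Continuous.div (by fun_prop) (by fun_prop) fun t => ?_)
      exact mul_ne_zero (ofReal_ne_zero.mpr hw) (by norm_cast; positivity)
    · exact (continuous_const.mul (continuous_ofReal.comp (Continuous.div (by fun_prop)
        (by fun_prop) (hden2 w hw)))).mul (hgc.comp hY)
    · exact (continuous_ofReal.comp (Continuous.div (by fun_prop) (by fun_prop)
        (hden2 w hw))).mul (hg₁c.comp hY)
  -- the dominating function
  set K : ℝ := 4 / w₀ ^ 2 * (π * |(k : ℝ)| * C₀ + C₁) with hK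
  have hbound : ∀ t : ℝ, ∀ w ∈ Set.Ioi (w₀ / 2), ‖F' w t‖ ≤
      Set.indicator (Set.Icc (-T₀) T₀) (fun _ => K) t := by
    intro t w hw
    rw [Set.mem_Ioi] at hw
    have hw' : 0 < w := by linarith
    by_cases ht : t ∈ Set.Icc (-T₀) T₀
    · rw [Set.indicator_of_mem ht]
      have hexp : ‖Complex.exp (2 * π * I * k * (-t / (w * (1 + t ^ 2))))‖ = 1 := by
        have e : (2 * π * I * k * (-t / (w * (1 + t ^ 2))) : ℂ) =
            ((2 * π * k * (-t / (w * (1 + t ^ 2))) : ℝ) : ℂ) * I := by push_cast; ring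
        rw [e, Complex.norm_exp_ofReal_mul_I]
      have hw2 : 1 / w ^ 2 ≤ 4 / w₀ ^ 2 := by
        rw [div_le_div_iff₀ (by positivity) (by positivity)]
        nlinarith
      have ht1 : |t| / (1 + t ^ 2) ≤ 1 / 2 := by
        rw [div_le_div_iff₀ (by positivity) (by positivity)]
        nlinarith [sq_abs t, sq_nonneg (|t| - 1), abs_nonneg t]
      have hA : ‖(2 * π * I * k * (t / (w ^ 2 * (1 + t ^ 2)) : ℝ) : ℂ)‖ ≤
          π * |(k : ℝ)| * (4 / w₀ ^ 2) := by
        rw [show (2 * π * I * k * ((t / (w ^ 2 * (1 + t ^ 2)) : ℝ) : ℂ)) =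
          ((2 * π * k * (t / (w ^ 2 * (1 + t ^ 2))) : ℝ) : ℂ) * I by push_cast; ring]
        rw [norm_mul, Complex.norm_I, mul_one, Complex.norm_real, Real.norm_eq_abs, abs_mul, abs_mul,
          abs_mul, abs_of_pos two_pos, abs_of_pos Real.pi_pos, abs_div,
          abs_of_pos (by positivity : (0:ℝ) < w ^ 2 * (1 + t ^ 2))]
        have e : |t| / (w ^ 2 * (1 + t ^ 2)) = (1 / w ^ 2) * (|t| / (1 + t ^ 2)) := by
          field_simp
        rw [e]
        calc 2 * π * |(k : ℝ)| * (1 / w ^ 2 * (|t| / (1 + t ^ 2)))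
            ≤ 2 * π * |(k : ℝ)| * (4 / w₀ ^ 2 * (1 / 2)) := by gcongr
          _ = π * |(k : ℝ)| * (4 / w₀ ^ 2) := by ring
      have hB : ‖(((-1 / (w ^ 2 * (1 + t ^ 2)) : ℝ) : ℂ))‖ ≤ 4 / w₀ ^ 2 := by
        rw [Complex.norm_real, Real.norm_eq_abs, abs_div, abs_neg, abs_one,
          abs_of_pos (by positivity : (0:ℝ) < w ^ 2 * (1 + t ^ 2))]
        calc 1 / (w ^ 2 * (1 + t ^ 2)) ≤ 1 / w ^ 2 := by
              apply div_le_div_of_nonneg_left zero_le_one (by positivity)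
              nlinarith [sq_nonneg t, sq_nonneg w]
          _ ≤ 4 / w₀ ^ 2 := hw2
      simp only [hF']
      rw [norm_mul, hexp, one_mul]
      calc _ ≤ ‖(2 * π * I * k * (t / (w ^ 2 * (1 + t ^ 2)) : ℝ) : ℂ) * g (1 / (w * (1 + t ^ 2)))‖ +
            ‖(((-1 / (w ^ 2 * (1 + t ^ 2)) : ℝ) : ℂ)) * g₁ (1 / (w * (1 + t ^ 2)))‖ := norm_add_le _ _
        _ ≤ π * |(k : ℝ)| * (4 / w₀ ^ 2) * C₀ + 4 / w₀ ^ 2 * C₁ :=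
            add_le_add ((norm_mul_le _ _).trans (mul_le_mul hA (hS₀ _) (norm_nonneg _)
              (by positivity)))
              ((norm_mul_le _ _).trans (mul_le_mul hB (hS₁ _) (norm_nonneg _) (by positivity)))
        _ = K := by rw [hK]; ring
    · rw [Set.indicator_of_notMem ht]
      have ht' : T₀ < |t| := by
        rw [Set.mem_Icc, ← abs_le] at ht
        exact not_le.mp ht
      rw [hzero w hw t ht', norm_zero]
  have hKint : Integrable (Set.indicator (Set.Icc (-T₀) T₀) fun _ : ℝ => K) volume :=
    (continuous_const.integrableOn_Icc (a := -T₀) (b := T₀)).integrable_indicator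
      measurableSet_Icc
  -- differentiability in `w` for fixed `t`
  have hdiff : ∀ t : ℝ, ∀ w ∈ Set.Ioi (w₀ / 2), HasDerivAt (fun w => F w t) (F' w t) w := by
    intro t w hw
    rw [Set.mem_Ioi] at hw
    have hw' : w ≠ 0 := by linarith
    have hX := hasDerivAt_X_w hw' t
    have hY := hasDerivAt_Y_w hw' t
    have hexp : HasDerivAt (fun w : ℝ => Complex.exp (2 * π * I * k * (-t / (w * (1 + t ^ 2)))))
        (Complex.exp (2 * π * I * k * (-t / (w * (1 + t ^ 2)))) *
          (2 * π * I * k * ((t / (w ^ 2 * (1 + t ^ 2)) : ℝ) : ℂ))) w := by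
      have h1 := ((hX.ofReal_comp).const_mul (2 * π * I * k)).cexp
      have e : (fun w : ℝ => Complex.exp (2 * π * I * k * (((-t / (w * (1 + t ^ 2))) : ℝ) : ℂ))) =
          fun w : ℝ => Complex.exp (2 * π * I * k * (-t / (w * (1 + t ^ 2)))) := by
        funext w; push_cast; ring_nf
      rw [e] at h1
      refine h1.congr_deriv ?_
      push_cast; ring_nf
    have hgw : HasDerivAt (fun w : ℝ => g (1 / (w * (1 + t ^ 2))))
        (((-1 / (w ^ 2 * (1 + t ^ 2)) : ℝ) : ℂ) * g₁ (1 / (w * (1 + t ^ 2)))) w := by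
      have := (hgd (1 / (w * (1 + t ^ 2)))).scomp w hY
      refine this.congr_deriv ?_
      rw [Complex.real_smul]
    have := hexp.mul hgw
    simp only [hF, hF']
    refine this.congr_deriv ?_
    ring
  -- apply dominated differentiation
  have hmain := hasDerivAt_integral_of_dominated_loc_of_deriv_le (μ := volume) (x₀ := w₀)
    (F := F) (F' := F') (s := Set.Ioi (w₀ / 2)) (bound := Set.indicator (Set.Icc (-T₀) T₀) fun _ => K)
    (Ioi_mem_nhds (by linarith)) ?_ ?_ ?_ ?_ hKint ?_
  · exact hmain.2
  · filter_upwards [Ioi_mem_nhds (by linarith : w₀ / 2 < w₀)] with w hw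
    exact (hcontF w (by rw [Set.mem_Ioi] at hw; linarith)).aestronglyMeasurable
  · -- `F w₀` is continuous with compact support
    refine (hcontF w₀ hw₀.ne').integrable_of_hasCompactSupport ?_
    refine HasCompactSupport.of_support_subset_isCompact (isCompact_Icc (a := -T₀) (b := T₀)) ?_
    intro t ht
    rw [Function.mem_support] at ht
    by_contra hcon
    rw [Set.mem_Icc, ← abs_le, not_le] at hcon
    apply ht
    simp only [hF, hgs _ (hsmall w₀ (by linarith) t hcon), mul_zero]
  · exact (hcontF' w₀ hw₀.ne').aestronglyMeasurable
  · exact ae_of_all _ fun t => hbound t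
  · exact ae_of_all _ fun t => hdiff t

/-! ### The bound `‖b_k'(w)‖ ≤ M'/(k² w)` -/

/-- **The coefficient derivative is `O(1/(k² w))` uniformly.** For a strip test `f`
(`0 < a ≤ b`) there is `M'` such that for all `w > 0` and `k ≠ 0` the `w`-derivative of the
coefficient `b_k(w)` (the integral of `hasDerivAt_coeff_integral`) has norm `≤ M'/(k² w)`.
Proof: `w b_k'(w) = 2πik ∫ e(kX) t G₃(Y) dt − ∫ e(kX) G₂(Y) dt` with `G₃`, `G₂` the
coefficients of the strip tests `(im z) f` and `(im z) Df·I`; the second integral is a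
coefficient of a horocycle integral (`exists_norm_coeffPsi_le`: `≤ M₂/|k|³`), the first is
`O(1/|k|⁵)` for `w ≤ 1/(3b)` by two integrations by parts (`norm_phase_integral_mul_le_of_le`
fed with the `C/|k|³` bounds of `exists_norm_coeff_le` for `G₃, G₃', G₃''`) and `O(1/|k|³)`
trivially for `w ≥ 1/(3b)`. [folklore] -/
theorem exists_norm_coeffDeriv_le (hf : ContDiff ℝ ∞ f) (hper : ∀ z, f (z + 1) = f z)
    (hsupp : ∀ z, f z ≠ 0 → a ≤ z.im ∧ z.im ≤ b) (ha : 0 < a) (hab : a ≤ b) :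
    ∃ M' : ℝ, 0 ≤ M' ∧ ∀ (w : ℝ), 0 < w → ∀ (k : ℤ), k ≠ 0 →
      ‖∫ t : ℝ, Complex.exp (2 * π * I * k * (-t / (w * (1 + t ^ 2)))) *
        ((2 * π * I * k * ((t / (w ^ 2 * (1 + t ^ 2)) : ℝ) : ℂ)) *
            (∫ x in (0:ℝ)..1, f (x + (1 / (w * (1 + t ^ 2)) : ℝ) * I) *
              Complex.exp (-(2 * π * I * k * x))) +
          ((-1 / (w ^ 2 * (1 + t ^ 2)) : ℝ) : ℂ) *
            ∫ x in (0:ℝ)..1, fderiv ℝ f (x + (1 / (w * (1 + t ^ 2)) : ℝ) * I) I *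
              Complex.exp (-(2 * π * I * k * x)))‖ ≤ M' / ((k : ℝ) ^ 2 * w) := by
  have hb : 0 < b := lt_of_lt_of_le ha hab
  -- the strip tests `F₃ = (im z) f`, `fI = Df·I`, `F₂ = (im z) fI`, and the derivatives of `F₃`
  set fI : ℂ → ℂ := fun z => fderiv ℝ f z I with hfI_def
  set F₃ : ℂ → ℂ := fun z => ((z.im : ℝ) : ℂ) * f z with hF₃_def
  set F₂ : ℂ → ℂ := fun z => ((z.im : ℝ) : ℂ) * fI z with hF₂_def
  set F₃' : ℂ → ℂ := fun z => fderiv ℝ F₃ z I with hF₃'_def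
  set F₃'' : ℂ → ℂ := fun z => fderiv ℝ F₃' z I with hF₃''_def
  have hfI : ContDiff ℝ ∞ fI := contDiff_fderiv_apply hf I
  have hpI : ∀ z, fI (z + 1) = fI z := periodic_fderiv_apply hper I
  have hsI : ∀ z, fI z ≠ 0 → a ≤ z.im ∧ z.im ≤ b := support_fderiv_apply hsupp I
  have hF₃ : ContDiff ℝ ∞ F₃ := contDiff_im_mul hf
  have hpF₃ : ∀ z, F₃ (z + 1) = F₃ z := periodic_im_mul hper
  have hsF₃ : ∀ z, F₃ z ≠ 0 → a ≤ z.im ∧ z.im ≤ b := support_im_mul hsupp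
  have hF₂ : ContDiff ℝ ∞ F₂ := contDiff_im_mul hfI
  have hpF₂ : ∀ z, F₂ (z + 1) = F₂ z := periodic_im_mul hpI
  have hsF₂ : ∀ z, F₂ z ≠ 0 → a ≤ z.im ∧ z.im ≤ b := support_im_mul hsI
  have hF₃' : ContDiff ℝ ∞ F₃' := contDiff_fderiv_apply hF₃ I
  have hpF₃' : ∀ z, F₃' (z + 1) = F₃' z := periodic_fderiv_apply hpF₃ I
  have hsF₃' : ∀ z, F₃' z ≠ 0 → a ≤ z.im ∧ z.im ≤ b := support_fderiv_apply hsF₃ I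
  have hF₃'' : ContDiff ℝ ∞ F₃'' := contDiff_fderiv_apply hF₃' I
  have hpF₃'' : ∀ z, F₃'' (z + 1) = F₃'' z := periodic_fderiv_apply hpF₃' I
  have hsF₃'' : ∀ z, F₃'' z ≠ 0 → a ≤ z.im ∧ z.im ≤ b := support_fderiv_apply hsF₃' I
  -- the uniform coefficient bounds `Cᵢ/|k|³`
  obtain ⟨C₀, hC₀0, hC₀⟩ := exists_norm_coeff_le hF₃ hpF₃ hsF₃
  obtain ⟨C₁, hC₁0, hC₁⟩ := exists_norm_coeff_le hF₃' hpF₃' hsF₃'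
  obtain ⟨C₂, hC₂0, hC₂⟩ := exists_norm_coeff_le hF₃'' hpF₃'' hsF₃''
  obtain ⟨M₂, hM₂0, hM₂⟩ := exists_norm_coeffPsi_le hF₂ hpF₂ hsF₂ ha hab
  refine ⟨2 * π * (150 * (2 * C₀ + 12 * b * C₁ + 4 * b ^ 2 * C₂) / ((2 * π) ^ 2 * a ^ 2)) +
    2 * π * (6 * b * C₀ / a) + M₂, by positivity, fun w hw k hk => ?_⟩
  have hk' : (0:ℝ) < |(k : ℝ)| := abs_pos.mpr (Int.cast_ne_zero.mpr hk)
  have hk0 : (k : ℝ) ≠ 0 := Int.cast_ne_zero.mpr hk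
  have hk1 : (1:ℝ) ≤ |(k : ℝ)| := by
    have : (1 : ℤ) ≤ |k| := Int.one_le_abs hk
    exact_mod_cast this
  -- the coefficient functions of `F₃` (and derivatives) and of `F₂` at frequency `k`
  set G : ℝ → ℂ := fun h => ∫ x in (0:ℝ)..1, F₃ (x + h * I) * Complex.exp (-(2 * π * I * k * x))
    with hG
  set G₁ : ℝ → ℂ := fun h => ∫ x in (0:ℝ)..1, F₃' (x + h * I) * Complex.exp (-(2 * π * I * k * x))
    with hG₁
  set G₂ : ℝ → ℂ := fun h => ∫ x in (0:ℝ)..1, F₃'' (x + h * I) * Complex.exp (-(2 * π * I * k * x))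
    with hG₂
  set H : ℝ → ℂ := fun h => ∫ x in (0:ℝ)..1, F₂ (x + h * I) * Complex.exp (-(2 * π * I * k * x))
    with hH
  have hGd : ∀ h, HasDerivAt G (G₁ h) h := fun h => hasDerivAt_coeff hF₃ hpF₃ hsF₃ k h
  have hG₁d : ∀ h, HasDerivAt G₁ (G₂ h) h := fun h => hasDerivAt_coeff hF₃' hpF₃' hsF₃' k h
  have hG₂c : Continuous G₂ := continuous_coeff hF₃'' hpF₃'' hsF₃'' k
  have hGs : ∀ h, G h ≠ 0 → a < h ∧ h < b := fun h hh => coeff_support hF₃.continuous hsF₃ k h hh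
  have hG₁s : ∀ h, G₁ h ≠ 0 → a < h ∧ h < b := fun h hh =>
    coeff_support hF₃'.continuous hsF₃' k h hh
  have hG₂s : ∀ h, G₂ h ≠ 0 → a < h ∧ h < b := fun h hh =>
    coeff_support hF₃''.continuous hsF₃'' k h hh
  have hSG : ∀ h, ‖G h‖ ≤ C₀ / |(k : ℝ)| ^ 3 := fun h => hC₀ h k hk
  have hSG₁ : ∀ h, ‖G₁ h‖ ≤ C₁ / |(k : ℝ)| ^ 3 := fun h => hC₁ h k hk
  have hSG₂ : ∀ h, ‖G₂ h‖ ≤ C₂ / |(k : ℝ)| ^ 3 := fun h => hC₂ h k hk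
  -- rewrite the derivative integrand: `(1/w) (2πik · t G(Y) − H(Y)) e(kX)`
  have hGY : ∀ t : ℝ, ((1 / (w * (1 + t ^ 2)) : ℝ) : ℂ) *
      (∫ x in (0:ℝ)..1, f (x + (1 / (w * (1 + t ^ 2)) : ℝ) * I) *
        Complex.exp (-(2 * π * I * k * x))) = G (1 / (w * (1 + t ^ 2))) := by
    intro t
    rw [hG]
    exact (coeff_im_mul f _ k).symm
  have hHY : ∀ t : ℝ, ((1 / (w * (1 + t ^ 2)) : ℝ) : ℂ) *
      (∫ x in (0:ℝ)..1, fI (x + (1 / (w * (1 + t ^ 2)) : ℝ) * I) *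
        Complex.exp (-(2 * π * I * k * x))) = H (1 / (w * (1 + t ^ 2))) := by
    intro t
    rw [hH]
    exact (coeff_im_mul fI _ k).symm
  have hw0 : (w : ℂ) ≠ 0 := ofReal_ne_zero.mpr hw.ne'
  have hrew : ∀ t : ℝ, Complex.exp (2 * π * I * k * (-t / (w * (1 + t ^ 2)))) *
      ((2 * π * I * k * ((t / (w ^ 2 * (1 + t ^ 2)) : ℝ) : ℂ)) *
          (∫ x in (0:ℝ)..1, f (x + (1 / (w * (1 + t ^ 2)) : ℝ) * I) *
            Complex.exp (-(2 * π * I * k * x))) +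
        ((-1 / (w ^ 2 * (1 + t ^ 2)) : ℝ) : ℂ) *
          ∫ x in (0:ℝ)..1, fderiv ℝ f (x + (1 / (w * (1 + t ^ 2)) : ℝ) * I) I *
            Complex.exp (-(2 * π * I * k * x))) =
      (1 / (w : ℂ)) * ((2 * π * I * k) * (Complex.exp (2 * π * I * k * (-t / (w * (1 + t ^ 2)))) *
        ((t : ℂ) * G (1 / (w * (1 + t ^ 2))))) -
        Complex.exp (2 * π * I * k * (-t / (w * (1 + t ^ 2)))) * H (1 / (w * (1 + t ^ 2)))) := by
    intro t
    rw [← hGY t, ← hHY t]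
    have ht : ((1 + t ^ 2 : ℝ) : ℂ) ≠ 0 := by norm_cast; positivity
    simp only [hfI_def]
    push_cast
    field_simp
    ring
  rw [integral_congr_ae (ae_of_all _ hrew), MeasureTheory.integral_const_mul]
  -- integrability of the two pieces (continuous, compactly supported)
  have hGc : Continuous G := continuous_iff_continuousAt.2 fun h => (hGd h).continuousAt
  have hHc : Continuous H := continuous_coeff hF₂ hpF₂ hsF₂ k
  have hHs : ∀ h, H h ≠ 0 → a < h ∧ h < b := fun h hh => coeff_support hF₂.continuous hsF₂ k h hh
  set T : ℝ := Real.sqrt (1 / (w * a)) with hT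
  have hsuppT : ∀ {K : ℝ → ℂ}, (∀ h, K h ≠ 0 → a < h ∧ h < b) → ∀ t : ℝ,
      K (1 / (w * (1 + t ^ 2))) ≠ 0 → t ∈ Set.Icc (-T) T := by
    intro K hKs t ht
    have := abs_lt_sqrt_of_apply_Y_ne_zero ha hw hKs ht
    rw [abs_lt] at this
    exact ⟨this.1.le, this.2.le⟩
  have hint1 : Integrable (fun t : ℝ => Complex.exp (2 * π * I * k * (-t / (w * (1 + t ^ 2)))) *
      ((t : ℂ) * G (1 / (w * (1 + t ^ 2))))) := by
    refine (continuous_phase_integrand_mul hw.ne' k hGc).integrable_of_hasCompactSupport ?_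
    refine HasCompactSupport.of_support_subset_isCompact (isCompact_Icc (a := -T) (b := T)) ?_
    intro t ht
    rw [Function.mem_support] at ht
    exact hsuppT hGs t fun h => ht (by rw [h, mul_zero, mul_zero])
  have hint2 : Integrable (fun t : ℝ => Complex.exp (2 * π * I * k * (-t / (w * (1 + t ^ 2)))) *
      H (1 / (w * (1 + t ^ 2)))) := by
    refine (continuous_phase_integrand hw.ne' k hHc).integrable_of_hasCompactSupport ?_
    refine HasCompactSupport.of_support_subset_isCompact (isCompact_Icc (a := -T) (b := T)) ?_
    intro t ht
    rw [Function.mem_support] at ht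
    exact hsuppT hHs t fun h => ht (by rw [h, mul_zero])
  rw [MeasureTheory.integral_sub (hint1.const_mul _) hint2, MeasureTheory.integral_const_mul]
  -- the two bounds
  have hJ : ‖∫ t : ℝ, Complex.exp (2 * π * I * k * (-t / (w * (1 + t ^ 2)))) *
      ((t : ℂ) * G (1 / (w * (1 + t ^ 2))))‖ ≤
      150 * (2 * C₀ + 12 * b * C₁ + 4 * b ^ 2 * C₂) / ((2 * π) ^ 2 * a ^ 2) / |(k : ℝ)| ^ 3 +
        6 * b * C₀ / a / |(k : ℝ)| ^ 3 := by
    have hk3 : (0:ℝ) < |(k : ℝ)| ^ 3 := by positivity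
    have hA0 : 0 ≤ 150 * (2 * C₀ + 12 * b * C₁ + 4 * b ^ 2 * C₂) / ((2 * π) ^ 2 * a ^ 2) /
        |(k : ℝ)| ^ 3 := by positivity
    have hB0 : 0 ≤ 6 * b * C₀ / a / |(k : ℝ)| ^ 3 := by positivity
    rcases le_or_gt w (1 / (3 * b)) with hwb | hwb
    · have h := norm_phase_integral_mul_le_of_le ha hab hw hwb hk hGd hG₁d hG₂c hSG hSG₁ hSG₂ hGs
        hG₁s hG₂s
      refine h.trans ?_
      have e : 150 * (2 * (C₀ / |(k : ℝ)| ^ 3) + 12 * b * (C₁ / |(k : ℝ)| ^ 3) +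
          4 * b ^ 2 * (C₂ / |(k : ℝ)| ^ 3)) / ((2 * π * (k : ℝ)) ^ 2 * a ^ 2) =
          150 * (2 * C₀ + 12 * b * C₁ + 4 * b ^ 2 * C₂) / ((2 * π) ^ 2 * a ^ 2) / |(k : ℝ)| ^ 3 /
            (k : ℝ) ^ 2 := by
        field_simp
      rw [e]
      have hk2 : (1:ℝ) ≤ (k : ℝ) ^ 2 := by nlinarith [sq_abs (k : ℝ)]
      calc _ ≤ 150 * (2 * C₀ + 12 * b * C₁ + 4 * b ^ 2 * C₂) / ((2 * π) ^ 2 * a ^ 2) / |(k : ℝ)| ^ 3 :=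
            div_le_self hA0 hk2
        _ ≤ _ := le_add_of_nonneg_right hB0
    · have h := norm_phase_integral_mul_le_of_ge k ha hab hw hwb.le hSG hGs
      refine h.trans ?_
      rw [show 6 * b * (C₀ / |(k : ℝ)| ^ 3) / a = 6 * b * C₀ / a / |(k : ℝ)| ^ 3 by field_simp]
      exact le_add_of_nonneg_left hA0
  have hI₂ : ‖∫ t : ℝ, Complex.exp (2 * π * I * k * (-t / (w * (1 + t ^ 2)))) *
      H (1 / (w * (1 + t ^ 2)))‖ ≤ M₂ / |(k : ℝ)| ^ 3 := by
    have h := hM₂ w hw k hk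
    rwa [coeff_integral_apply_hpt hF₂.continuous hpF₂ hsF₂ ha hw k] at h
  -- assemble
  have hn2πk : ‖(2 * π * I * k : ℂ)‖ = 2 * π * |(k : ℝ)| := by
    rw [show (2 * π * I * k : ℂ) = ((2 * π * k : ℝ) : ℂ) * I by push_cast; ring, norm_mul,
      Complex.norm_I, mul_one, Complex.norm_real, Real.norm_eq_abs, abs_mul, abs_mul,
      abs_of_pos two_pos, abs_of_pos Real.pi_pos]
  rw [norm_mul, norm_div, norm_one, Complex.norm_real, Real.norm_of_nonneg hw.le]
  rw [div_mul_eq_mul_div, one_mul, div_le_div_iff₀ hw (by positivity)]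
  have hk3 : |(k : ℝ)| ^ 3 = (k : ℝ) ^ 2 * |(k : ℝ)| := by
    rw [pow_succ, sq_abs]
  set A : ℝ := 150 * (2 * C₀ + 12 * b * C₁ + 4 * b ^ 2 * C₂) / ((2 * π) ^ 2 * a ^ 2) with hA
  set B : ℝ := 6 * b * C₀ / a with hB
  have hA0 : 0 ≤ A := by positivity
  have hB0 : 0 ≤ B := by positivity
  calc ‖(2 * π * I * k) * (∫ t : ℝ, Complex.exp (2 * π * I * k * (-t / (w * (1 + t ^ 2)))) *
          ((t : ℂ) * G (1 / (w * (1 + t ^ 2))))) -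
        (∫ t : ℝ, Complex.exp (2 * π * I * k * (-t / (w * (1 + t ^ 2)))) * H (1 / (w * (1 + t ^ 2))))‖ *
        ((k : ℝ) ^ 2 * w)
      ≤ (2 * π * |(k : ℝ)| * (A / |(k : ℝ)| ^ 3 + B / |(k : ℝ)| ^ 3) + M₂ / |(k : ℝ)| ^ 3) *
          ((k : ℝ) ^ 2 * w) := by
        refine mul_le_mul_of_nonneg_right ?_ (by positivity)
        refine (norm_sub_le _ _).trans (add_le_add ?_ hI₂)
        rw [norm_mul, hn2πk]
        exact mul_le_mul_of_nonneg_left hJ (by positivity)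
    _ = (2 * π * (A + B) + M₂ / |(k : ℝ)|) * w := by
        rw [hk3]
        field_simp
    _ ≤ (2 * π * A + 2 * π * B + M₂) * w := by
        refine mul_le_mul_of_nonneg_right ?_ hw.le
        have : M₂ / |(k : ℝ)| ≤ M₂ := div_le_self hM₂0 hk1
        linarith

end HorocyclePhase

end Literature.NumberTheory.LFunctions

end
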